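import Literature.NumberTheory.Automorphic.Liu2021.AppendixC.Glue
import Literature.NumberTheory.Automorphic.Liu2021.Prop413MultLeOneOfAsPrinted
import HarnessLib

/-!
# [Liu2021, Prop. 4.13]'s datum PRESENTED THROUGH APPENDIX C over μ-UNIFORM oscillator carriers, with `H¹_{B,τ'}(A_∞, ℂ)` read as a
# consumer's tower module — and the multiplicity pin of the Δ2 junctions in the LITERAL currency `Prop413AsPrinted P`

Topic `NumberTheory/Automorphic/Liu2021/AppendixC`.  Cell pub-hodgecm2 (COR-CM), Δ2 BRIDGE («EXECUTION NOW», coordinator 2026-08-23T12:17Z;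
BRIDGE-PLAN v2 §3 R2, item L2.1); seat prover-pub-hodgecm-own-htheta-g9-0.  Two structures, two definitions, `rfl` lemmas and one theorem;
nothing of [Liu2021] is asserted; no named fact; HOLE-FREE (Literature only).

WHY.  The Δ2 junctions (`…AppendixCGood`, `…AppendixCGoodProp413`) are written over App-C-presented rests `R : Thm418Rest C` — one per
weight-one character `μ` — whose Weil-side carriers `Eps ∕ epsOf ∕ Chi ∕ omega ∕ rho` are FIELDS OF THE REST, hence a priori `μ`-dependent;
[Liu2021, Prop. 4.13] (`Prop413AsPrinted P`, `P : Prop413Data F E`) speaks about ONE family `ω(μ, ε, χ)` over ALL adèlic oscillator triples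
(Def. 4.11: every conjugate-symplectic `μ`, no weight condition) and ONE tower `H¹_{B,τ'}(A_∞, ℂ)`.  To cite Prop. 4.13 LITERALLY at the
junctions one needs (a) μ-UNIFORM carriers and rests built from them, and (b) a `Prop413Data` whose `HB τ'` IS the consumer's tower module
`H` and whose summands ARE the rests' summands, definitionally.  This file supplies exactly that:

* `UniformOmega C` — the μ-uniform Weil-side carriers over an App-C datum `C : Sec42Data P5 isotropicAt` (Def. 4.11 over all conjugate
  symplectic `μ`): `Eps`, `epsOf`, `Chi`, `omega μ hμ ε χ`, `rho μ hμ ε χ : Representation ℂ C.G (omega μ hμ ε χ)`;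
* `RestTail C μ hμ` — the remaining (genuinely per-character) fields of a `Thm418Rest C`: weight one, `Obj`, `Aμ`, `Ω(μ)`,
  `rhoΩ`, `res`, `res_pull` (Def. 4.5, Def. 4.16, Rem. 4.17);
* `UniformOmega.rest U t : Thm418Rest C` — the rest at `μ` with carriers from `U` and remainder `t`;
* `UniformOmega.prop413Data U H : Prop413Data F E` — Prop. 4.13's datum with `n := P5.n`, `𝕍 := P5.𝕍`, `G := C.G`, the carriers of `U`,
  and **`HB _ := H`, `rhoB _ := Representation.ofModule' H`** for the consumer's `ℂ[C.G]`-module `H` (the model's tower; the typing caveat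
  «`HB` constant in `τ'`» is BRIDGE-PLAN §2 T1: `Prop413AsPrinted` then reads Prop. 4.13 at the one `τ'` of interest repeated over `τ'`);
* `UniformOmega.admTripleOfRest`, `rhoAt_toThm418Data_rest` (`rfl`): an admissible index of `toThm418Data C (U.rest t)` IS an admissible
  triple of `U.prop413Data H`, with the same summand ON THE NOSE;
* `UniformOmega.rank_intertwiningMap_rhoAt_rest_le_one_of_prop413AsPrinted` — THE MULTIPLICITY PIN `hmultD` of the junctions for every
  rest of the form `U.rest t`, from the LITERAL cite `h413 : Prop413AsPrinted (U.prop413Data H)` + Def. 4.11's adjectives of its summands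
  (`h411`) + their pairwise non-isomorphy (`hsep`) + one compact open subgroup (`hK`) — by `Prop413Data.rank_intertwiningMap_rhoAt_le_one_of_asPrinted`
  (Schur, ✔ `AdmissibleDirectSumMultiplicityOne`); NO `hirrD ∕ hnvD` binder (the source summand is a `P`-summand).

HC_CM is NOT proved; «Δ2 BRIDGE CLOSED» is NOT claimed; whether a consumer's rests ARE of the form `U.rest t` (item6-p3's
`restOfCharD ∕ restOfCharRep` are, field for field, by construction) is the consumer's `rfl`.

## References
* [Liu2021] Def. 4.11 (ll. 2083–2097), Def. 4.12, Prop. 4.13 (ll. 2113–2119) and proof l. 2145, Def. 4.5, Def. 4.16, Rem. 4.17, Thm. 4.18,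
  §4.2 ll. 2053–2081, App. C l. 4618–4637.
* Tree: `AppendixC.Sec42Data`, `AppendixC.Thm418Rest`, `AppendixC.toThm418Data` (`Glue.lean`); `Prop413Data`, `Prop413AsPrinted`,
  `Prop413Data.rank_intertwiningMap_rhoAt_le_one_of_asPrinted` (`Prop413MultLeOneOfAsPrinted.lean`).
-/

noncomputable section

open CategoryTheory NumberField
open Literature.AlgebraicGeometry.Motives (AbelianVariety)

namespace Literature.NumberTheory.Automorphic.Liu2021.AppendixC

variable {F E : Type} [Field F] [NumberField F] [IsTotallyReal F] [Field E] [NumberField E] [Algebra F E]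
  [IsTotallyComplex E] [Algebra.IsQuadraticExtension F E]
variable {P5 : PropC5Data F E} {isotropicAt : ℕ → Prop}

/-- **μ-UNIFORM oscillator carriers over an Appendix-C datum** ([Liu2021, Def. 4.11] over ALL adèlic oscillator triples: `μ` conjugate
symplectic (Def. 4.1), `ε ∈ Eps`, `χ ∈ Chi`): the five Weil-side ⟨CARRIER⟩ fields of `Thm418Rest` ∕ `Prop413Data`, once for every `μ`,
with the `𝔾(𝔸_F^∞) = C.G`-action.  Nothing asserted. [cite: Liu2021, Def. 4.11 (ll. 2083–2097) and Def. 4.12] -/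
structure UniformOmega (C : Sec42Data P5 isotropicAt) : Type 1 where
  /-- ⟨CARRIER⟩ the collections `ε` (Def. 4.11, second bullet), as `Thm418Data.Eps` ∕ `Prop413Data.Eps`. -/
  Eps : Type
  /-- ⟨CARRIER⟩ `e ↦ (e · Nm E_v^×)_v` (Def. 4.12, first bullet), as `Thm418Data.epsOf`. -/
  epsOf : E → Eps
  /-- ⟨CARRIER⟩ the automorphic characters `χ` of `E¹\(𝔸_E^∞)¹` (Def. 4.11, third bullet), as `Thm418Data.Chi`. -/
  Chi : Type
  /-- ⟨CARRIER⟩ `ω(μ, ε, χ)` for EVERY conjugate-symplectic `μ` (Def. 4.11), as `Prop413Data.omega`. -/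
  omega : ∀ μ : IdeleClassGroup E →ₜ* Circle,
    (letI : IsCMField E := isCMField F E; IdeleClassGroup.IsConjugateSymplectic E μ) → Eps → Chi → Type
  [instAddCommGroupOmega : ∀ μ hμ ε χ, AddCommGroup (omega μ hμ ε χ)]
  [instModuleOmega : ∀ μ hμ ε χ, Module ℂ (omega μ hμ ε χ)]
  /-- ⟨CARRIER⟩ the action of `𝔾(𝔸_F^∞) = C.G` on `ω(μ, ε, χ)` (Def. 4.11), as `Prop413Data.rho`. -/
  rho : ∀ μ hμ ε χ, Representation ℂ C.G (omega μ hμ ε χ)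

attribute [instance] UniformOmega.instAddCommGroupOmega UniformOmega.instModuleOmega

/-- **The per-character remainder of a `Thm418Rest`** at a conjugate-symplectic `μ`: weight one (Def. 4.16), the objects `D_μ` of `𝒜(μ)`
with their abelian varieties `A_μ` (Def. 4.5), `Ω(μ)` with its `M_μ[𝔾(𝔸_F^∞)]`-structure (Def. 4.16) and the canonical maps
`Hom_E(A_K, A_μ)_ℚ → Ω(μ)` (Rem. 4.17) — i.e. the fields of `Thm418Rest C` that are NOT the μ-uniform carriers of a `UniformOmega C`.  Nothing asserted.
[cite: Liu2021, Def. 4.5, Def. 4.16, Rem. 4.17] -/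
structure RestTail (C : Sec42Data P5 isotropicAt) (μ : IdeleClassGroup E →ₜ* Circle)
    (hμ : letI : IsCMField E := isCMField F E; IdeleClassGroup.IsConjugateSymplectic E μ) : Type 1 where
  /-- «of weight one» (Def. 4.16; Def. 4.3 (1)). -/
  hasWeight_one : letI : IsCMField E := isCMField F E; IdeleClassGroup.HasWeight E μ 1
  /-- ⟨CARRIER⟩ as `Thm418Rest.Obj`. -/
  Obj : Type
  /-- as `Thm418Rest.Aμ`. -/
  Aμ : Obj → AbelianVariety E
  /-- ⟨CARRIER⟩ as `Thm418Rest.Ω`. -/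
  Ω : Type
  [instAddCommGroupΩ : AddCommGroup Ω]
  [instModuleΩ : Module (fieldOfValues E μ) Ω]
  /-- ⟨CARRIER⟩ as `Thm418Rest.rhoΩ`. -/
  rhoΩ : Representation (fieldOfValues E μ) C.G Ω
  /-- ⟨CARRIER⟩ as `Thm418Rest.res`. -/
  res : ∀ (K : C5.SmallLevel C.S.K₀) (D : Obj), C.HomQ K (Aμ D) →+ Ω
  /-- as `Thm418Rest.res_pull`. -/
  res_pull : ∀ {K K' : C5.SmallLevel C.S.K₀} (f : K' ⟶ K) (D : Obj) (φ : C.HomQ K (Aμ D)),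
    res K' D (Sec42Data.HomQ.pull C f (Aμ D) φ) = res K D φ

attribute [instance] RestTail.instAddCommGroupΩ RestTail.instModuleΩ

namespace UniformOmega

variable {C : Sec42Data P5 isotropicAt} (U : UniformOmega C)

/-- **The rest at `μ` assembled from the uniform carriers and a tail**: `Thm418Rest C` with `Eps ∕ epsOf ∕ Chi ∕ omega ∕ rho` from `U`
(at `μ`) and the remaining fields from `t`. [cite: Liu2021, Def. 4.11, Def. 4.16, Thm. 4.18] -/
def rest {μ : IdeleClassGroup E →ₜ* Circle}
    {hμ : letI : IsCMField E := isCMField F E; IdeleClassGroup.IsConjugateSymplectic E μ} (t : RestTail C μ hμ) : Thm418Rest C where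
  Eps := U.Eps
  epsOf := U.epsOf
  Chi := U.Chi
  μ := μ
  isConjugateSymplectic := hμ
  hasWeight_one := t.hasWeight_one
  Obj := t.Obj
  Aμ := t.Aμ
  omega := U.omega μ hμ
  instAddCommGroupOmega := fun ε χ => U.instAddCommGroupOmega μ hμ ε χ
  instModuleOmega := fun ε χ => U.instModuleOmega μ hμ ε χ
  rho := U.rho μ hμ
  Ω := t.Ω
  instAddCommGroupΩ := t.instAddCommGroupΩ
  instModuleΩ := t.instModuleΩ
  rhoΩ := t.rhoΩ
  res := t.res
  res_pull := t.res_pull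

/-- **[Liu2021, Prop. 4.13]'s datum over the uniform carriers, with `H¹_{B,τ'}(A_∞, ℂ)` READ AS the consumer's tower module `H`**:
`n := P5.n`, `𝕍 := P5.𝕍`, `G := C.G = 𝔾(𝔸_F^∞)`, the carriers of `U`, `HB _ := H` and `rhoB _ := Representation.ofModule' H` (the
`ℂ[C.G]`-module structure of `H`).  A consumer citing `Prop413AsPrinted (U.prop413Data H)` cites Prop. 4.13 with ITS OWN constructed tower for
`H¹_{B,τ'}(A_∞, ℂ)` (BRIDGE-PLAN §2 T1: constant in `τ'`, i.e. read at the one embedding of interest).  Nothing asserted.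
[cite: Liu2021, Prop. 4.13 (ll. 2113–2119), §4.2 ll. 2053–2081] -/
def prop413Data (H : Type) [AddCommGroup H] [Module ℂ H] [Module (MonoidAlgebra ℂ C.G) H]
    [IsScalarTower ℂ (MonoidAlgebra ℂ C.G) H] : Prop413Data F E where
  n := P5.n
  two_le_n := C.two_le_n
  𝕍 := P5.𝕍
  G := C.G
  Eps := U.Eps
  epsOf := U.epsOf
  Chi := U.Chi
  omega := U.omega
  rho := U.rho
  HB := fun _ => H
  rhoB := fun _ => Representation.ofModule' (k := ℂ) (G := C.G) H

/-- An admissible index `(ε, χ)` of Thm. 4.18's datum at the rest `U.rest t` IS an admissible triple `(μ, ε, χ)` of `U.prop413Data H`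
(same admissibility clause Def. 4.12 at `Φ_μ`, plus weight one from the tail). [cite: Liu2021, Def. 4.12, Prop. 4.13, Thm. 4.18] -/
def admTripleOfRest (H : Type) [AddCommGroup H] [Module ℂ H] [Module (MonoidAlgebra ℂ C.G) H]
    [IsScalarTower ℂ (MonoidAlgebra ℂ C.G) H] {μ : IdeleClassGroup E →ₜ* Circle}
    {hμ : letI : IsCMField E := isCMField F E; IdeleClassGroup.IsConjugateSymplectic E μ} (t : RestTail C μ hμ)
    (i : (toThm418Data C (U.rest t)).AdmIndex) : (U.prop413Data H).AdmTriple :=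
  ⟨⟨μ, hμ, i.1.1, i.1.2⟩, t.hasWeight_one, i.2⟩

/-- `admTripleOfRest` is injective. [cite: Liu2021, Prop. 4.13 and Thm. 4.18] -/
theorem admTripleOfRest_injective (H : Type) [AddCommGroup H] [Module ℂ H] [Module (MonoidAlgebra ℂ C.G) H]
    [IsScalarTower ℂ (MonoidAlgebra ℂ C.G) H] {μ : IdeleClassGroup E →ₜ* Circle}
    {hμ : letI : IsCMField E := isCMField F E; IdeleClassGroup.IsConjugateSymplectic E μ} (t : RestTail C μ hμ) :
    Function.Injective (U.admTripleOfRest H t) := fun i j hij => by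
  have h1 := congrArg (fun s : (U.prop413Data H).AdmTriple => (s.1.ε, s.1.χ)) hij
  exact Subtype.ext (Prod.ext (congrArg Prod.fst h1) (congrArg Prod.snd h1))

/-- … with the same summand ON THE NOSE: `ω_{(ε,χ)}` of Thm. 4.18 at `U.rest t` is `ω_{(μ,ε,χ)}` of `U.prop413Data H` (`rfl`).
[cite: Liu2021, Prop. 4.13 and Thm. 4.18] -/
theorem omegaAt_toThm418Data_rest (H : Type) [AddCommGroup H] [Module ℂ H] [Module (MonoidAlgebra ℂ C.G) H]
    [IsScalarTower ℂ (MonoidAlgebra ℂ C.G) H] {μ : IdeleClassGroup E →ₜ* Circle}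
    {hμ : letI : IsCMField E := isCMField F E; IdeleClassGroup.IsConjugateSymplectic E μ} (t : RestTail C μ hμ)
    (i : (toThm418Data C (U.rest t)).AdmIndex) :
    (toThm418Data C (U.rest t)).omegaAt i = (U.prop413Data H).omegaAt (U.admTripleOfRest H t i) := rfl

/-- … and the same action (`rfl`). [cite: Liu2021, Prop. 4.13 and Thm. 4.18] -/
theorem rhoAt_toThm418Data_rest (H : Type) [AddCommGroup H] [Module ℂ H] [Module (MonoidAlgebra ℂ C.G) H]
    [IsScalarTower ℂ (MonoidAlgebra ℂ C.G) H] {μ : IdeleClassGroup E →ₜ* Circle}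
    {hμ : letI : IsCMField E := isCMField F E; IdeleClassGroup.IsConjugateSymplectic E μ} (t : RestTail C μ hμ)
    (i : (toThm418Data C (U.rest t)).AdmIndex) :
    (toThm418Data C (U.rest t)).rhoAt i = (U.prop413Data H).rhoAt (U.admTripleOfRest H t i) := rfl

/-- **THE MULTIPLICITY PIN `hmultD` OF THE Δ2 JUNCTIONS, in the LITERAL currency of [Liu2021, Prop. 4.13] AS PRINTED**, for every rest
of the form `U.rest t`: `dim_ℂ Hom_{ℂ[𝔾(𝔸_F^∞)]}(ω_i, H) ≤ 1` for every admissible index `i` of `toThm418Data C (U.rest t)`, from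
`h413 : Prop413AsPrinted (U.prop413Data H)` (the `ℂ[𝔾(𝔸_F^∞)]`-isomorphism of the consumer's tower with `⊕_t ω_t`, ll. 2113–2119), Def. 4.11's
adjectives of the summands (`h411`), their pairwise non-isomorphy (`hsep`: Thm. 4.18 (2) ∕ App. D Lem. D.1 (3)) and one compact open subgroup
(`hK`) — Schur's lemma for irreducible admissible representations (`Prop413Data.rank_intertwiningMap_rhoAt_le_one_of_asPrinted`).  The source
summand IS a summand of `U.prop413Data H` (`rhoAt_toThm418Data_rest`), so no separate irreducibility ∕ non-vanishing binder is asked.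
[cite: Liu2021, Prop. 4.13 (ll. 2113–2119) with proof l. 2145; Def. 4.11; Thm. 4.18 (2); App. D Lemma D.1 (3)] -/
theorem rank_intertwiningMap_rhoAt_rest_le_one_of_prop413AsPrinted (H : Type) [AddCommGroup H] [Module ℂ H]
    [Module (MonoidAlgebra ℂ C.G) H] [IsScalarTower ℂ (MonoidAlgebra ℂ C.G) H]
    (h413 : Prop413AsPrinted (U.prop413Data H)) (hn : 3 ≤ P5.n) (τ' : E →+* ℂ)
    (h411 : ∀ t : (U.prop413Data H).AdmTriple, IsIrreducibleOrZero ((U.prop413Data H).rhoAt t) ∧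
      IsSmoothRep ((U.prop413Data H).rhoAt t) ∧ IsAdmissibleRep ((U.prop413Data H).rhoAt t))
    (hsep : ∀ s t : (U.prop413Data H).AdmTriple, Nontrivial ((U.prop413Data H).omegaAt s) →
      (∃ f : (U.prop413Data H).omegaAt s ≃ₗ[ℂ] (U.prop413Data H).omegaAt t,
        ∀ (g : C.G) (v : (U.prop413Data H).omegaAt s), f ((U.prop413Data H).rhoAt s g v) = (U.prop413Data H).rhoAt t g (f v)) →
      s = t)
    (hK : ∃ K : Subgroup C.G, IsOpenCompact K) {μ : IdeleClassGroup E →ₜ* Circle}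
    {hμ : letI : IsCMField E := isCMField F E; IdeleClassGroup.IsConjugateSymplectic E μ} (t : RestTail C μ hμ)
    (i : (toThm418Data C (U.rest t)).AdmIndex) :
    Module.rank ℂ (Representation.IntertwiningMap ((toThm418Data C (U.rest t)).rhoAt i)
      (Representation.ofModule' (k := ℂ) (G := C.G) H)) ≤ 1 :=
  Prop413Data.rank_intertwiningMap_rhoAt_le_one_of_asPrinted h413 hn τ' h411 hsep hK (U.admTripleOfRest H t i)

end UniformOmega

end Literature.NumberTheory.Automorphic.Liu2021.AppendixC

end
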